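import Summits.MatrixMultiplication.MatrixMultiplication.Theses.HessianPlane
import Literature.Computability.AlgebraicComplexity.CoppersmithWinograd1990Proofs

/-!
# `HessianPlane.CWPointAssembly` (stmt-MatrixMultiplication-0589) — proved

The support item `CWPointAssembly` of route `MatrixMultiplication/HessianPlane` (identical signature
to `AsymptoticRankCW.Assembly`, shared item `stmt-MatrixMultiplication-0589`): the growth form of
"`R̃(T_cw,2) ≤ 3`" — for every `ε > 0`, `R(T_cw,2^{⊠N}) = O(3^{(1+ε)N})`, Kronecker power written
inline on `(Fin N → Fin 3)³` — implies `MatrixMultiplication` (`ω(ℂ) = 2`).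

Proof: the PROVED asymptotic-rank form of the Coppersmith–Winograd 1990 "easy" laser-method bound,
`CoppersmithWinograd1990_asymptoticRank_form_holds` (CoppersmithWinograd1990Proofs.lean), specialised
to `q = 2`, `ρ = 3`, gives `ω(ℂ) ≤ log₂(4·3³/27) = 2` (`omega_le_two_of_cw_two`); the flattening
lower frame `omega_two_le ℂ : 2 ≤ ω(ℂ)` (FlatteningBound.lean) closes, packaged as
`matrixMultiplication_of_cw_two`. No unproved named fact is assumed.
-/

namespace Summit.MatrixMultiplication.MatrixMultiplication.Theorems

open Literature.Computability.AlgebraicComplexity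

-- single-conjunct summit: the canonical namespace `Summit.MatrixMultiplication.MatrixMultiplication`
-- (Sub = Summit, D-0017) necessarily repeats `MatrixMultiplication`; silence only that linter here.
set_option linter.dupNamespace false in
/-- **Support item `CWPointAssembly` of route `HessianPlane` (stmt-MatrixMultiplication-0589), exact
signature**: the growth-form asymptotic-rank-3 statement for the small Coppersmith–Winograd tensor
`T_cw,2` implies `MatrixMultiplication` (`ω(ℂ) = 2`). Composition of the proved Literature theorems
`matrixMultiplication_of_cw_two`, `CoppersmithWinograd1990_asymptoticRank_form_holds` (`q = 2`,
`ρ = 3`: `ω(ℂ) ≤ log₂ 4 = 2`) and `omega_two_le ℂ` (`2 ≤ ω(ℂ)`).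
[cite: ConnerGesmundoLandsbergVentura2022, Thm 1.1 and p. 3 (BCS97 Ex. 15.24)] -/
theorem cwPointAssembly_proof :
    Summit.MatrixMultiplication.MatrixMultiplication.Theses.HessianPlane.CWPointAssembly := by
  unfold Summit.MatrixMultiplication.MatrixMultiplication.Theses.HessianPlane.CWPointAssembly
  intro hX
  exact matrixMultiplication_of_cw_two CoppersmithWinograd1990_asymptoticRank_form_holds
    (omega_two_le ℂ) hX

end Summit.MatrixMultiplication.MatrixMultiplication.Theorems
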